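import Literature.Computability.AlgebraicComplexity.BI17TernaryCubicOddInvariants
import Literature.Computability.AlgebraicComplexity.BI17DegreeExponentMonoidProofs
import Literature.Computability.AlgebraicComplexity.BI17GenericTernaryCubicPeriodGuard
import Literature.Computability.AlgebraicComplexity.BI17GenericTernaryCubicPolystable
import Mathlib.RingTheory.RootsOfUnity.Complex
import HarnessLib

/-!
# `a(3,3) = a'(3,3) = 2`: almost all ternary cubics have stabilizer period `2`, and the
# `GL₃`-orbit closure of a generic ternary cubic is NOT normal (BI 2017 Thm. 2.3 / App. Prop. 7.5 (1),
# Cor. 3.17 (1) at `(D, m) = (3, 3)`)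

Sibling proof file of `Literature/Computability/AlgebraicComplexity/BI17FundamentalInvariantForms.lean`
(cell `val-lit`, DAG row BI2017-A). P. Bürgisser, C. Ikenmeyer, J. Algebra 477 (2017) =
arXiv:1511.02927: Thm. 2.3 lists `a'(3,3) = 2` (App. Prop. 7.5 (1): "a generic `w ∈ Sym³ℂ³` satisfies
`stab(w) ≃ μ₃ ⋊ S₃`. Hence `a'(3,3) = 2`"), and Cor. 3.17 (1): "if `a(w) < D` then `\overline{Gw}` is
not normal". Here, composing tree theorems only:

* upper bound `det(stab w)² = 1` for every cubic `w` at which SOME `SL₃`-invariants of degrees `4`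
  and `6` do not vanish (they exist and are non-zero: `genericDegreeMonoid_three_three`, val-lit-p4 —
  Aronhold's `S` and `T` in all but name; an `SL₃`-invariant of degree `d` transforms under `stab(w)`
  by `det^{3d/3} = det^d`, t09's `IsSLInvariantCoord.aeval_formCoeff_linSubstRep_eq_det_pow`, so
  `det⁴ = det⁶ = 1`);
* lower bound `a(w) ≠ 1` for smooth cubics (`stabilizerPeriod_ne_one_of_forall_regular`: the swap
  `x ↔ y` of a Hesse model has determinant `−1`);
* hence `a(w) = 2` on the Zariski-generic set {`S T ≠ 0`} ∩ {smooth}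
  (`isZariskiGeneric_stabilizerPeriod_eq_two_three_three`), `a'(w) = a(w)·gcd(3,3)/3 = 2`
  (`isZariskiGeneric_reducedStabilizerPeriod_eq_two_three_three` — the TRUE clause of the refuted
  App. Prop. 7.5, cf. `not_BI2017_prop_A_5`), and with `BI2017_prop_2_10_three_three` (generic
  polystability) and t09's `BI2017_cor_3_17_1`: **for almost all ternary cubics `w`, the orbit closure
  `\overline{GL₃ w}` is not normal** (`isZariskiGeneric_not_isIntegrallyClosed_orbitCoordRing_three_three`).

The printed route (Hessian covariant + stabilizer of `XYZ`) is replaced by the degree argument; the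
precise group `μ₃ ⋊ S₃` is NOT determined here. Everything PROVED; no definitions, no facts; nothing
here bears on `VP` versus `VNP`.
-/

noncomputable section

open MvPolynomial

namespace Literature.Computability.AlgebraicComplexity

/-- Non-zero `SL₃`-invariants of ternary cubics exist in every even degree `≠ 2` (Aronhold; tree:
`genericDegreeMonoid_three_three`). [cite: BurgisserIkenmeyer2017, Ex. 3.7] -/
theorem exists_isSLInvariantCoord_three_three {d : ℕ} (hd : Even d) (hd2 : d ≠ 2) :
    ∃ F : MvPolynomial (DegIdx (Fin 3) 3) ℂ, F.IsHomogeneous d ∧ IsSLInvariantCoord 3 F ∧ F ≠ 0 := by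
  have h : d ∈ genericDegreeMonoid (Fin 3) ℂ 3 := by
    rw [genericDegreeMonoid_three_three]
    exact ⟨hd, hd2⟩
  exact h

/-- **`det(g)^d · F(w) = F(w)` for `g ∈ stab(w)`** and an `SL₃`-invariant `F` of degree `d` on ternary
cubics; hence `det(g)^d = 1` when `F(w) ≠ 0`. [cite: BurgisserIkenmeyer2017, Lemma 3.2 (1) (proof)] -/
theorem det_pow_eq_one_of_mem_linStabilizer {w : MvPolynomial (Fin 3) ℂ} (hw : w.IsHomogeneous 3)
    {F : MvPolynomial (DegIdx (Fin 3) 3) ℂ} {d : ℕ} (hFd : F.IsHomogeneous d) (hFi : IsSLInvariantCoord 3 F)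
    (hFw : aeval (formCoeff 3 w) F ≠ 0) {g : GL (Fin 3) ℂ} (hg : g ∈ linStabilizer w) :
    ((Matrix.GeneralLinearGroup.det g : ℂˣ) : ℂ) ^ d = 1 := by
  have h := hFi.aeval_formCoeff_linSubstRep_eq_det_pow (m := 3) (n := d) (by norm_num) hw hFd
    (by ring) g
  have hgw : linSubstRep (Fin 3) ℂ g w = w := hg
  rw [hgw] at h
  -- `F(w) = det^d F(w)` with `F(w) ≠ 0`
  have := mul_right_cancel₀ hFw (h.symm.trans (one_mul _).symm)
  exact this

/-- **Upper bound `det(stab w) ≤ μ₂`**: if some `SL₃`-invariants of degrees `4` and `6` do not vanish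
at the ternary cubic `w`, every `g ∈ stab(w)` has `det(g)² = 1`.
[cite: BurgisserIkenmeyer2017, App. Prop. 7.5 (1)] -/
theorem stabilizerDetImage_le_rootsOfUnity_two {w : MvPolynomial (Fin 3) ℂ} (hw : w.IsHomogeneous 3)
    {F₄ F₆ : MvPolynomial (DegIdx (Fin 3) 3) ℂ} (h₄d : F₄.IsHomogeneous 4) (h₄i : IsSLInvariantCoord 3 F₄)
    (h₆d : F₆.IsHomogeneous 6) (h₆i : IsSLInvariantCoord 3 F₆) (h₄w : aeval (formCoeff 3 w) F₄ ≠ 0)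
    (h₆w : aeval (formCoeff 3 w) F₆ ≠ 0) : stabilizerDetImage w ≤ rootsOfUnity 2 ℂ := by
  intro u hu
  rw [mem_stabilizerDetImage_iff] at hu
  obtain ⟨g, hg, rfl⟩ := hu
  rw [mem_rootsOfUnity, Units.ext_iff, Units.val_pow_eq_pow_val, Units.val_one]
  have h4 := det_pow_eq_one_of_mem_linStabilizer hw h₄d h₄i h₄w hg
  have h6 := det_pow_eq_one_of_mem_linStabilizer hw h₆d h₆i h₆w hg
  set δ := ((Matrix.GeneralLinearGroup.det g : ℂˣ) : ℂ)
  have hδ : δ ≠ 0 := by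
    intro h0
    rw [h0, zero_pow (by norm_num)] at h4
    exact zero_ne_one h4
  -- `δ² = δ⁶ / δ⁴`
  have : δ ^ 2 * δ ^ 4 = δ ^ 6 := by ring
  rw [h4, h6, mul_one] at this
  exact this

/-- **`a(w) = 2`** for a ternary cubic which is smooth and at which some `SL₃`-invariants of degrees
`4` and `6` do not vanish: `det(stab w) ≤ μ₂` (above) and `≠ 1` (`stabilizerPeriod_ne_one_of_forall_regular`).
[cite: BurgisserIkenmeyer2017, App. Prop. 7.5 (1)] -/
theorem stabilizerPeriod_eq_two_of_invariants_of_forall_regular {w : MvPolynomial (Fin 3) ℂ}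
    (hw : w.IsHomogeneous 3)
    {F₄ F₆ : MvPolynomial (DegIdx (Fin 3) 3) ℂ} (h₄d : F₄.IsHomogeneous 4) (h₄i : IsSLInvariantCoord 3 F₄)
    (h₆d : F₆.IsHomogeneous 6) (h₆i : IsSLInvariantCoord 3 F₆) (h₄w : aeval (formCoeff 3 w) F₄ ≠ 0)
    (h₆w : aeval (formCoeff 3 w) F₆ ≠ 0)
    (hreg : ∀ p : Fin 3 → ℂ, p ≠ 0 → eval p w = 0 → (fun i => eval p (pderiv i w)) ≠ 0) :
    stabilizerPeriod w = 2 := by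
  have hle := stabilizerDetImage_le_rootsOfUnity_two hw h₄d h₄i h₆d h₆i h₄w h₆w
  have hdvd : Nat.card (stabilizerDetImage w) ∣ 2 := by
    have h := Subgroup.card_dvd_of_le hle
    rwa [Complex.card_rootsOfUnity 2] at h
  have hne : stabilizerPeriod w ≠ 1 := stabilizerPeriod_ne_one_of_forall_regular hw hreg
  rw [stabilizerPeriod_def] at hne ⊢
  have hle2 : Nat.card (stabilizerDetImage w) ≤ 2 := Nat.le_of_dvd two_pos hdvd
  interval_cases h : Nat.card (stabilizerDetImage w)
  · -- `0 ∣ 2` is false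
    norm_num at hdvd
  · exact absurd rfl hne
  · rfl

/-- A non-zero coordinate polynomial defines a Zariski-generic non-vanishing locus.
[cite: BurgisserIkenmeyer2017, §2.1 ("almost all")] -/
private theorem isZariskiGeneric_aeval_ne_zero {D : ℕ} {F : MvPolynomial (DegIdx (Fin 3) D) ℂ}
    (hF : F ≠ 0) : IsZariskiGeneric D fun w : MvPolynomial (Fin 3) ℂ => aeval (formCoeff D w) F ≠ 0 :=
  ⟨F, hF, fun _ _ h => h⟩

/-- **BI 2017 Thm. 2.3 / App. Prop. 7.5 (1), the value `a(3,3) = 2`: almost all ternary cubics have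
stabilizer period `2`** (`det(stab w) = {±1}` generically). [cite: BurgisserIkenmeyer2017, Thm. 2.3 and App. Prop. 7.5 (1)] -/
theorem isZariskiGeneric_stabilizerPeriod_eq_two_three_three :
    IsZariskiGeneric 3 fun w : MvPolynomial (Fin 3) ℂ => stabilizerPeriod w = 2 := by
  obtain ⟨F₄, h₄d, h₄i, h₄0⟩ := exists_isSLInvariantCoord_three_three (d := 4) (by decide) (by decide)
  obtain ⟨F₆, h₆d, h₆i, h₆0⟩ := exists_isSLInvariantCoord_three_three (d := 6) (by decide) (by decide)
  have hgen := ((isZariskiGeneric_aeval_ne_zero h₄0).and (isZariskiGeneric_aeval_ne_zero h₆0)).and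
    (isZariskiGeneric_forall_exists_eval_pderiv_ne_zero (n := 1) (D := 3) (by norm_num))
  refine hgen.mono fun w hw h => ?_
  obtain ⟨⟨h₄w, h₆w⟩, hsm⟩ := h
  have hreg : ∀ p : Fin 3 → ℂ, p ≠ 0 → eval p w = 0 → (fun i => eval p (pderiv i w)) ≠ 0 := by
    intro p hp hwp hgrad
    obtain ⟨j, hj⟩ := hsm p hp hwp
    exact hj (congr_fun hgrad j)
  exact stabilizerPeriod_eq_two_of_invariants_of_forall_regular hw h₄d h₄i h₆d h₆i h₄w h₆w hreg

/-- **`a'(3,3) = 2`** (BI Thm. 2.3; the true clause of App. Prop. 7.5 (1)): almost all ternary cubics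
have reduced stabilizer period `2`. [cite: BurgisserIkenmeyer2017, Thm. 2.3 ("a'(3,3) = 2")] -/
theorem isZariskiGeneric_reducedStabilizerPeriod_eq_two_three_three :
    IsZariskiGeneric 3 fun w : MvPolynomial (Fin 3) ℂ => reducedStabilizerPeriod 3 w = 2 := by
  refine isZariskiGeneric_stabilizerPeriod_eq_two_three_three.mono fun w _ h => ?_
  rw [reducedStabilizerPeriod, h, Fintype.card_fin]
  decide

/-- **BI 2017 Cor. 3.17 (1) at `(D, m) = (3, 3)`: the `GL₃`-orbit closure of a generic ternary cubic
is NOT normal** — almost all ternary cubics `w` are polystable (`BI2017_prop_2_10_three_three`) with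
`a(w) = 2 < 3 = D`, so `O(\overline{GL₃ w})` is not integrally closed (t09's `BI2017_cor_3_17_1`).
[cite: BurgisserIkenmeyer2017, Cor. 3.17 (1) (with Thm. 2.3, a(3,3) = 2)] -/
theorem isZariskiGeneric_not_isIntegrallyClosed_orbitCoordRing_three_three :
    IsZariskiGeneric 3 fun w : MvPolynomial (Fin 3) ℂ => ¬ IsIntegrallyClosed (OrbitCoordRing w 3) := by
  have hgen := (isZariskiGeneric_stabilizerPeriod_eq_two_three_three.and BI2017_prop_2_10_three_three).and
    (isZariskiGeneric_forall_exists_eval_pderiv_ne_zero (n := 1) (D := 3) (by norm_num))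
  refine hgen.mono fun w hw h => ?_
  obtain ⟨⟨h2, hpoly⟩, hsm⟩ := h
  have hw0 : w ≠ 0 := by
    rintro rfl
    obtain ⟨j, hj⟩ := hsm (fun _ => 1) (fun h => one_ne_zero (congr_fun h 0)) (map_zero _)
    exact hj (by rw [map_zero, map_zero])
  exact BI2017_cor_3_17_1 (by norm_num) hw hw0 hpoly (by rw [h2]; norm_num)

/-! ### The `(3, 3)` conjuncts of the two refuted typed facts, individually confirmed -/

/-- **The FIRST conjunct of the (refuted-as-a-whole) `BI2017_prop_A_5` holds**: "a generic
`w ∈ Sym³ℂ³` … `a'(3,3) = 2`" — literally the first component of the typed conjunction (whose second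
component, `a'(4,3) = 2`, is false: `not_BI2017_prop_A_5`). [cite: BurgisserIkenmeyer2017, §7 (Appendix) Prop. 7.5 (1)] -/
theorem BI2017_prop_A_5_conjunct_one :
    IsZariskiGeneric 3 (fun f : MvPolynomial (Fin 3) ℂ => reducedStabilizerPeriod 3 f = 2) :=
  isZariskiGeneric_reducedStabilizerPeriod_eq_two_three_three

/-- **The `(D, m) = (3, 3)` instance of the (refuted-as-a-whole) `BI2017_thm_2_3_period` holds**:
at `D = 3`, `m = 3` the printed case distinction evaluates to `2`, and almost all ternary cubics have
`a'(w) = 2`. [cite: BurgisserIkenmeyer2017, Thm. 2.3 ("a'(3,3) = 2")] -/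
theorem BI2017_thm_2_3_period_three_three :
    IsZariskiGeneric 3 fun f : MvPolynomial (Fin 3) ℂ =>
      reducedStabilizerPeriod 3 f =
        if (3 = 3 ∧ 3 = 2) ∨ (3 = 3 ∧ 3 = 3) ∨ (3 = 4 ∧ 3 = 3) then 2 else 1 := by
  refine isZariskiGeneric_reducedStabilizerPeriod_eq_two_three_three.mono fun f _ h => ?_
  rw [h]
  decide

end Literature.Computability.AlgebraicComplexity

end
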